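import Summits.HodgeConjecture.HodgeConjecture.Theorems.H413E2SWIdentityCloseCore
import HarnessLib

/-!
# H413 · E-2 · SW2 identity road (W): the I-CLOSE CORE on the split-place MARGINALS (`Y`-free form)

Cell `hodgecm-mathlib`, crux H413 (stmt-HodgeConjecture-24833), child line `Cruxes/H413/Lines/F0_E2SiegelWeilWeilRange.lean`, stub
`stub_SW2_siegelWeil` (iii); F0P4-plan (g4) rulings 2026-08-31T03:36:58Z (1) «WEIGHTS» / 03:37:45Z: the outer I-CLOSE tests `𝟙_A ⊗ φ`
with Schwartz weights `φ` on `Y = X□(𝔸^{(v)})`, so the CORE ★ `H413E2SWIdentityCloseCore.prod_eq_smul_prod_of_dilate_bound` is applied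
to the `φ₊ / φ₋`-weighted `X_v`-MARGINALS — measures on `X_v = K^ι × K^ι` alone.  This sibling states that `Y`-free form directly
(closer-modulo-letters, Literature + own ★ Theorems imports only, no `Cruxes/**/Lines/*`).  HC_CM is proved only modulo the 7 printed
citations until rung 0 closes; nothing here is about Hodge classes.

* **`measure_eq_smul_of_dilate_bound`** — `m̂, m′ : Measure (K^ι × K^ι)` finite on compacts, `GL_ι(K)`-invariant (dual-pair action
  `(x, y) ↦ (g x, (g⁻¹)ᵀ y)`), carried by the split locus `S_b`; if `|m̂(D_n).toReal − κ₀ · m′(D_n).toReal| ≤ M ‖t n‖^γ` along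
  `‖t n‖ → ∞` with `γ < |ι| − 1` (`D_n` the dilated unit box), then `m̂ = κ₀ • m′` — via the `Y`-free (J-v) ★ `exists_eq_smul_fibreMeasure`
  (`m̂ = ĉ • μ_{b,v}`, `m′ = c′ • μ_{b,v}`) and (CV-v) ★ `eq_zero_of_integral_fibreMeasure_dilate_bound` (`ĉ = κ₀ c′`); no (RECT) needed.
-/

set_option autoImplicit false
-- the cell's `Summit.HodgeConjecture.HodgeConjecture.…` namespace repeats the summit name by design (D-0017 layout)
set_option linter.dupNamespace false

noncomputable section

open MeasureTheory Filter Topology Set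
open scoped NNReal ENNReal Matrix Pointwise
open Literature.NumberTheory.Automorphic Literature.NumberTheory.Weil1965.SplitPlace
open Literature.NumberTheory.GaloisRepresentations.IsNonarchimedeanLocalField

namespace Summit.HodgeConjecture.HodgeConjecture.Cruxes.H413.E2SWIdentityCloseCore

variable {K : Type*} [Field K] [ValuativeRel K] [TopologicalSpace K] [IsNonarchimedeanLocalField K]
variable {ι : Type*} [Fintype ι] [MeasurableSpace K] [BorelSpace K] (μ : Measure K) [μ.IsAddHaarMeasure]

include μ in
/-- **I-CLOSE CORE ON THE MARGINALS (`Y`-free)** [Weil1965 n° 51, (39)–(40)].  Two measures `m̂`, `m′` on `K^ι × K^ι` (`|ι| ≥ 2`), finite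
on compacts, invariant under the dual-pair action of `GL_ι(K)` and carried by the split locus `S_b = {x ⬝ᵥ y = b, x ≠ 0, y ≠ 0}`, whose
dilated-box masses satisfy `|m̂(D_n).toReal − κ₀ · m′(D_n).toReal| ≤ M ‖t n‖^γ` along a sequence `‖t n‖ → ∞` with `γ < |ι| − 1`, coincide
up to `κ₀`: `m̂ = κ₀ • m′`.  (`μ` is any Haar measure on `K`; it fixes the reference fibre measure `μ_{b,v}` of the proof.) -/
theorem measure_eq_smul_of_dilate_bound [Nonempty ι] [DecidableEq ι] [MeasurableSingletonClass K]
    (hι : 2 ≤ Fintype.card ι) (b : K) (κ₀ : ℝ≥0) (mhat m' : Measure ((ι → K) × (ι → K)))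
    [IsFiniteMeasureOnCompacts mhat] [IsFiniteMeasureOnCompacts m']
    (hinv : ∀ (g : GL ι K) (A : Set ((ι → K) × (ι → K))), MeasurableSet A →
      mhat ((fun z => (((g : Matrix ι ι K) *ᵥ z.1, ((g⁻¹ : GL ι K) : Matrix ι ι K)ᵀ *ᵥ z.2) :
        (ι → K) × (ι → K))) ⁻¹' A) = mhat A)
    (hcar : mhat {z : (ι → K) × (ι → K) | z.1 ⬝ᵥ z.2 = b ∧ z.1 ≠ 0 ∧ z.2 ≠ 0}ᶜ = 0)
    (hinv' : ∀ (g : GL ι K) (A : Set ((ι → K) × (ι → K))), MeasurableSet A →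
      m' ((fun z => (((g : Matrix ι ι K) *ᵥ z.1, ((g⁻¹ : GL ι K) : Matrix ι ι K)ᵀ *ᵥ z.2) :
        (ι → K) × (ι → K))) ⁻¹' A) = m' A)
    (hcar' : m' {z : (ι → K) × (ι → K) | z.1 ⬝ᵥ z.2 = b ∧ z.1 ≠ 0 ∧ z.2 ≠ 0}ᶜ = 0)
    {t : ℕ → K} (ht0 : ∀ n, t n ≠ 0) (ht : Tendsto (fun n => (normAbs K (t n) : ℝ)) atTop atTop)
    {M γ : ℝ} (hγ : γ < (Fintype.card ι : ℝ) - 1)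
    (hbd : ∀ n, |(mhat {z : (ι → K) × (ι → K) | ((t n)⁻¹ • z.1, z.2) ∈ piPrimePowBall K ι 0 ×ˢ piPrimePowBall K ι 0}).toReal -
        (κ₀ : ℝ) * (m' {z : (ι → K) × (ι → K) | ((t n)⁻¹ • z.1, z.2) ∈ piPrimePowBall K ι 0 ×ˢ piPrimePowBall K ι 0}).toReal|
      ≤ M * (normAbs K (t n) : ℝ) ^ γ) :
    mhat = κ₀ • m' := by
  -- (J-v), `Y`-free: both are multiples of the fibre measure `μ_{b,v}`
  obtain ⟨chat, hchat⟩ := exists_eq_smul_fibreMeasure μ hι b mhat hinv hcar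
  obtain ⟨c', hc'⟩ := exists_eq_smul_fibreMeasure μ hι b m' hinv' hcar'
  -- the bound in (CV-v)'s shape for `c := chat − κ₀ c'`
  have hkey : (chat : ℝ) - κ₀ * c' = 0 := by
    refine eq_zero_of_integral_fibreMeasure_dilate_bound μ hι (c := (chat : ℝ) - κ₀ * c') (M := M) hγ b ht0 ht fun n => ?_
    rw [← measureReal_dilateBox_eq_integral μ hι b (t n)⁻¹]
    have h := hbd n
    rw [hchat, hc'] at h
    simp only [Measure.smul_apply, ENNReal.smul_def, smul_eq_mul, ENNReal.toReal_mul, ENNReal.coe_toReal] at h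
    rw [← mul_assoc, ← sub_mul, abs_mul] at h
    convert h using 2
  have hc : chat = κ₀ * c' := by
    have h : (chat : ℝ) = κ₀ * c' := sub_eq_zero.1 hkey
    exact_mod_cast h
  rw [hchat, hc', hc, mul_smul, ENNReal.smul_def, ENNReal.smul_def]

end Summit.HodgeConjecture.HodgeConjecture.Cruxes.H413.E2SWIdentityCloseCore

end
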